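import Mathlib
import Summits.Ventures.PercRepro2.SwAllMarkStepH1

/-!
# The general mark step with one (H1) junction: the instance `exH1` (blind cell PercRepro2,
night-4 g33, 2026-08-28; proofs/NIGHT4-G33.md §5)

`exH1` = `0–3, 0–5, 1–3, 1–5, 2–4, 2–5, 3–4, 4–5` with `l = 0`, `h = 2` and the mark `1`: in the
isolated graph `G − 1` the vertex `4` (joined to `h` by the single edge `2–4`, not joined to `l`)
is an (H1) junction — its neighbours are `h`, the vertex `5` (joined to `h`) and the vertex `3`,
alone in its component of `(G − 1)[{0}ᶜ ∖ {2, 4}]` once the mark is isolated — and every other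
vertex is joined to `l`: **`swAll_exH1 : SwAll exH1 0 2 1`** by `swAll_markStep_of_junctionH1_edge`.
In `G` itself `4` is a MIXED junction (the component of `3` in `G[{0}ᶜ ∖ {2, 4}]` carries the
neighbour `5` of `h`, through the mark `1`): the first of the 81 (graph, marking) pairs at `n = 6`
outside every theorem of record before this step (NIGHT4-G33.md §1).
-/

namespace Summit.Ventures.PercRepro2

namespace LocRows

open Hull

open scoped Classical

/-- `0–3, 0–5, 1–3, 1–5, 2–4, 2–5, 3–4, 4–5`: with `l = 0`, `h = 2`, the mark `1`, the vertex `4`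
is an (H1) junction of the isolated graph joined to `h` by the single edge `2–4`. -/
def exH1 : Fin 8 → Sym2 (Fin 6)
  | 0 => s(0, 3) | 1 => s(0, 5) | 2 => s(1, 3) | 3 => s(1, 5) | 4 => s(2, 4) | 5 => s(2, 5)
  | 6 => s(3, 4) | 7 => s(4, 5)

/-- The isolated graph `exH1 − 1`: the edges `1–3` and `1–5` become loops at `1`. -/
lemma isolate_exH1 (e : Fin 8) : isolate exH1 1 e = if e = 2 ∨ e = 3 then s(1, 1) else exH1 e := by
  fin_cases e <;> simp [isolate, exH1]

/-- The component of `3` in the isolated graph restricted to `{0}ᶜ ∖ {2, 4}` is `{3}`. -/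
lemma compU_exH1_three : compU (isolate exH1 1) ({0}ᶜ) 2 4 3 ⊆ {3} := by
  intro q hq
  refine mem_of_conn_of_closed (ends := isolate exH1 1) ?_ (Set.mem_singleton 3) hq
  intro y hy z hyz
  rw [Set.mem_singleton_iff] at hy
  subst hy
  obtain ⟨hne, e, he, hends⟩ := openGraph_adj.1 hyz
  simp only [decide_eq_true_eq] at he
  obtain ⟨a, ha, b, hb, hab⟩ := he
  rw [isolate_exH1] at hends hab
  fin_cases e <;> simp [exH1] at hends hab ⊢ <;>
    rcases hab with ⟨rfl, rfl⟩ | ⟨rfl, rfl⟩ <;> simp_all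

/-- The component of `2` in the isolated graph restricted to `{0}ᶜ ∖ {2, 4}` is `{2}`. -/
lemma compU_exH1_two : compU (isolate exH1 1) ({0}ᶜ) 2 4 2 ⊆ {2} := by
  intro q hq
  refine mem_of_conn_of_closed (ends := isolate exH1 1) ?_ (Set.mem_singleton 2) hq
  intro y hy z hyz
  rw [Set.mem_singleton_iff] at hy
  subst hy
  obtain ⟨hne, e, he, hends⟩ := openGraph_adj.1 hyz
  simp only [decide_eq_true_eq] at he
  obtain ⟨a, ha, b, hb, hab⟩ := he
  rw [isolate_exH1] at hends hab
  fin_cases e <;> simp [exH1] at hends hab ⊢ <;>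
    rcases hab with ⟨rfl, rfl⟩ | ⟨rfl, rfl⟩ <;> simp_all

/-- The vertex `4` is an (H1) junction of the isolated graph: its neighbours `2 = h`, `3` (alone
in its component of `(G − 1)[{0}ᶜ ∖ {2, 4}]`, not joined to `h`) and `5` (joined to `h`). -/
lemma H1_exH1 : H1 (isolate exH1 1) ({0}ᶜ) 2 4 := by
  intro e p he
  rw [isolate_exH1] at he
  fin_cases e <;> simp [exH1] at he
  · -- the edge `2–4`: `p = 2`
    subst he
    refine Or.inr fun q hq e' => ?_
    rw [Set.mem_singleton_iff.1 (compU_exH1_two hq), isolate_exH1]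
    fin_cases e' <;> simp [exH1]
  · -- the edge `3–4`: `p = 3`
    subst he
    refine Or.inr fun q hq e' => ?_
    rw [Set.mem_singleton_iff.1 (compU_exH1_three hq), isolate_exH1]
    fin_cases e' <;> simp [exH1]
  · -- the edge `4–5`: `p = 5`, joined to `h` by `2–5`
    subst he
    exact Or.inl ⟨5, by rw [isolate_exH1]; simp [exH1]⟩

/-- **Row 2′SW-ALL on `exH1`** with `l = 0`, `h = 2`, the mark `1`: the (H1) junction `4` of the
isolated graph joined to `h` by the single edge `2–4` — the first of the 81 (graph, marking) pairs
at `n = 6` outside every theorem of record before this step (census, NIGHT4-G33.md §1). -/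
theorem swAll_exH1 : SwAll exH1 0 2 1 := by
  refine swAll_markStep_of_junctionH1_edge (u := 4) (e₀ := 4) (by decide) ?_ (by decide) (by decide)
    (by decide) (by decide) (by decide) ?_ rfl ?_ H1_exH1 ?_
  · intro e; fin_cases e <;> decide
  · intro e; fin_cases e <;> decide
  · intro e he; fin_cases e <;> simp [exH1] at he ⊢
  · intro y hy0 hy2 hy1 hy4
    fin_cases y
    · exact absurd rfl hy0
    · exact absurd rfl hy1
    · exact absurd rfl hy2
    · exact Or.inl ⟨0, by simp [exH1, Sym2.eq_swap]⟩
    · exact absurd rfl hy4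
    · exact Or.inl ⟨1, by simp [exH1, Sym2.eq_swap]⟩

/-- **Row (SW) on `exH1`.** -/
theorem sw_exH1 : Sw exH1 0 2 1 := sw_of_swAll exH1 swAll_exH1

end LocRows

end Summit.Ventures.PercRepro2
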